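import Mathlib.Analysis.Fourier.LpSpace
import Mathlib.Analysis.MellinInversion
import Mathlib.MeasureTheory.Function.JacobianOneDim
import Mathlib.MeasureTheory.Function.Holder
import Literature.Analysis.FunctionSpaces.PlancherelL1L2
import HarnessLib

/-!
# The Mellin–Plancherel transform: `L²((0,∞), dt) ≃ L²(ℝ)` on the critical line `Re s = ½`

RH-FREE infrastructure (real/harmonic analysis on the half-line; cell rh-crit, row «dbl:R18-M1»;
bears_on LADDER-RH COLUMN 6 (DBR) as TOOLING ONLY). WHAT THIS IS NOT: nothing in this file mentions
`ζ`, its zeros or RH; nothing here bears on the truth of RH.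

The Mellin transform `𝓜f(s) = ∫₀^∞ f(t) t^{s−1} dt` (Mathlib's `mellin`) restricted to the critical
line `s = ½ + iτ` is, after the substitution `t = e^{−u}`, the Fourier transform of
`G(u) = e^{−u/2} f(e^{−u})` (Mathlib `mellin_eq_fourier`: `𝓜f(s) = 𝓕G(Im s/2π)`), and `f ↦ G` is
unitary `L²((0,∞), dt) → L²(ℝ, du)`.  Composing with Mathlib's `L²` Fourier transform
(`MeasureTheory.Lp.fourierTransformₗᵢ`, Plancherel) gives the **Mellin–Plancherel transform** as a
LINEAR ISOMETRY EQUIVALENCE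

* `mellinL2 : Lp ℂ 2 (volume.restrict (Ioi 0)) ≃ₗᵢ[ℂ] Lp ℂ 2 (volume : Measure ℝ)`,

parametrising the critical line by `s = ½ + 2πiξ`, `ξ ∈ ℝ` (so that both sides carry LEBESGUE
measure; in the `τ = 2πξ` parametrisation the map is `√(2π)` times an isometry onto `L²(dτ)`, i.e.
an isometry onto `L²(ℝ, dτ/2π)` — Titchmarsh's normalisation, Thm. 71).  Main statements:

* `mellinL2_toLp_ae_eq_mellin` — **the dictionary**: for `f ∈ L²(0,∞)` whose Mellin transform
  converges absolutely on `Re s = ½` (`MellinConvergent f (1/2)`, i.e. `f ∈ L¹(t^{−1/2}dt)`),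
  `mellinL2 f = (ξ ↦ 𝓜f(½ + 2πiξ))` a.e.; in Burnol's right-Mellin notation `f̂(s) = ∫₀^∞ f(t)t^{−s}dt
  = 𝓜f(1 − s)` this reads `(mellinL2 f)(ξ) = f̂(½ − 2πiξ)`;
* `norm_mellinL2` / `integral_norm_sq_mellinL2` — Plancherel/Parseval `‖mellinL2 f‖ = ‖f‖`,
  `∫_ℝ ‖(mellinL2 f)(ξ)‖² dξ = ∫₀^∞ ‖f‖²`; the classical `τ`-form
  `∫_ℝ ‖𝓜f(½ + iτ)‖² dτ = 2π ∫₀^∞ ‖f‖²` on `L¹(t^{−1/2}dt) ∩ L²` is the tree's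
  `Literature.Analysis.FunctionSpaces.integral_norm_sq_mellin_half_eq` (not restated);
* surjectivity / inversion are the `≃ₗᵢ` structure (`mellinL2.symm`, `mellinL2.surjective`);
* the transport pieces are exposed for re-use: `MellinL2.expNegMeasure` (`e^{−u}du`),
  `MellinL2.measurePreserving_exp_neg` (`u ↦ e^{−u}` pushes `e^{−u}du` to `dt` on `(0,∞)`),
  `MellinL2.compExpNeg` (`L²((0,∞),dt) ≃ₗᵢ L²(ℝ, e^{−u}du)`), `MellinL2.expWeight`
  (`L²(ℝ, e^{−u}du) ≃ₗᵢ L²(ℝ, du)`, `h ↦ e^{−u/2}h`), `MellinL2.expTransport` (their composite `U`,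
  `(Uf)(u) = e^{−u/2}f(e^{−u})`), each with its a.e. formula (`coeFn_…`).
* `mellinL2_ae_eq_of_comp_mul` / `mellinL2_toLp_comp_mul` — **the dilation law**
  `𝓜(f(c·))(ξ) = c^{−(½+2πiξ)}·(𝓜f)(ξ)` a.e. (`c > 0`) at the operator level (the `L²` form of
  Mathlib's function-level `mellin_comp_mul_left`; Burnol: the Mellin transform diagonalises the
  scale invariant operators, §1 p. 4, TeX l.355–358): under `U` the dilation is `c^{−1/2}` times the
  translation by `log c` (`expTransport_eq_of_comp_mul`), and the `L²` Fourier transform turns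
  translations into phases (`fourier_compSubRight`: `𝓕(u(· − a)) = e^{−2πia·}𝓕u`, Grafakos
  Prop. 2.2.11 (6) extended to `L²` by Schwartz density; the phase acts through Mathlib's
  `HSMul (Lp ℂ ∞ μ) (Lp ℂ 2 μ) (Lp ℂ 2 μ)` on the class `(memLp_top_phase a).toLp _`); with the
  dilation tools on `(0,∞)`
  `measurePreserving_mul_left_Ioi`, `memLp_comp_mul_Ioi`, `eLpNorm_comp_mul_Ioi`,
  `norm_toLp_comp_mul_Ioi` (`‖f(c·)‖ = c^{−1/2}‖f‖`).

References (held, TeX of record `dbl/src/Burnol2004JTNB_arXivmath0203120v7.tex`): J.-F. Burnol,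
arXiv:math/0203120v7 §1 p. 4, TeX l.350–355: «Let us now write `f̂(s) = ∫₀^∞ f(t)t^{−s}dt` for the
right Mellin Transform, as opposed to the left Mellin Transform `∫₀^∞ f(t)t^{s−1}dt`. These transforms
are unitary identifications of `K = L²(0,∞; dt)` with `L²(s = ½ + iτ; dτ/2π)`» — THIS is the statement
formalised here [Burnol2004b]; §4 TeX l.633–638 («after a change of variable») for the transport.
L. Grafakos, *Classical Fourier Analysis*, 3rd ed., GTM 249 (2014), Prop. 2.2.11 (6)
(`(τ^y f)^(ξ) = e^{−2πiy·ξ}f̂(ξ)`, PDF p. 126 of the held copy) and §2.2.4 (PDF pp. 129–130, extension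
to `L²`) [Grafakos2014].  Classical source: E. C. Titchmarsh, *Introduction to the theory of Fourier integrals* (1948), Thm. 71
(Mellin–Parseval), as cited by the tree's `PlancherelL1L2.lean` (not held; secondary).  Mathlib search: `mellin_eq_fourier`,
`MeasureTheory.Lp.fourierTransformₗᵢ`, `MeasureTheory.Lp.compMeasurePreservingₗᵢ`,
`lintegral_image_eq_lintegral_abs_deriv_mul`, `withDensity_absolutelyContinuous'`,
`VectorFourier.fourierIntegral_comp_add_right`, `MeasureTheory.Lp.coeFn_lpSMul` (`L^∞` acting on
`L²`), `Real.map_volume_mul_left`, `mellin_comp_mul_left`; the tree's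
`fourier_toLp_ae_eq_fourierIntegral`, `integrableOn_Ioi_iff_integrable_exp_neg_smul`
(`PlancherelL1L2.lean`).  No Mathlib or tree declaration provides the `L²` operator (checked
`lean search 'mellinL2|MellinPlancherel'`).
-/

noncomputable section

open MeasureTheory Real Complex Set Filter FourierTransform
open scoped ENNReal Topology

namespace Literature.Analysis.FunctionSpaces

namespace MellinL2

/-! ## The weighted measure `e^{−u} du` and the substitution `t = e^{−u}` -/

/-- The measure `ν = e^{−u} du` on `ℝ`: the pull-back of Lebesgue measure on `(0,∞)` under
`u ↦ e^{−u}`. [cite: Burnol2004b, §1 p. 4 (arXiv:math/0203120v7, TeX l.350–355) and §4 (TeX l.633–638)] -/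
def expNegMeasure : Measure ℝ := volume.withDensity fun u ↦ ENNReal.ofReal (Real.exp (-u))

/-- The density `e^{−u}` is measurable. [cite: Burnol2004b, §1 p. 4 (arXiv:math/0203120v7, TeX l.350–355) and §4 (TeX l.633–638)] -/
theorem measurable_density : Measurable fun u : ℝ ↦ ENNReal.ofReal (Real.exp (-u)) :=
  ENNReal.measurable_ofReal.comp (Real.measurable_exp.comp measurable_neg)

/-- `e^{−u}du ≪ du`. [cite: Burnol2004b, §1 p. 4 (arXiv:math/0203120v7, TeX l.350–355) and §4 (TeX l.633–638)] -/
theorem expNegMeasure_absolutelyContinuous : expNegMeasure ≪ volume :=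
  withDensity_absolutelyContinuous _ _

/-- `du ≪ e^{−u}du` (the density is everywhere positive). [cite: Burnol2004b, §1 p. 4 (arXiv:math/0203120v7, TeX l.350–355) and §4 (TeX l.633–638)] -/
theorem absolutelyContinuous_expNegMeasure : (volume : Measure ℝ) ≪ expNegMeasure :=
  withDensity_absolutelyContinuous' measurable_density.aemeasurable
    (Eventually.of_forall fun _ ↦ (ENNReal.ofReal_pos.2 (Real.exp_pos _)).ne')

/-- a.e. equality for `e^{−u}du` is a.e. equality for `du`. [cite: Burnol2004b, §1 p. 4 (arXiv:math/0203120v7, TeX l.350–355) and §4 (TeX l.633–638)] -/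
theorem ae_eq_expNegMeasure_iff {β : Type*} {f g : ℝ → β} :
    f =ᵐ[expNegMeasure] g ↔ f =ᵐ[volume] g :=
  withDensity_ae_eq measurable_density.aemeasurable
    (Eventually.of_forall fun _ ↦ (ENNReal.ofReal_pos.2 (Real.exp_pos _)).ne')

/-- **The substitution `t = e^{−u}`**: `u ↦ e^{−u}` is measure preserving from `(ℝ, e^{−u}du)` onto
`((0,∞), dt)`. [cite: Burnol2004b, §1 p. 4 (arXiv:math/0203120v7, TeX l.350–355) and §4 (TeX l.633–638)] -/
theorem measurePreserving_exp_neg :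
    MeasurePreserving (fun u : ℝ ↦ Real.exp (-u)) expNegMeasure (volume.restrict (Ioi 0)) := by
  have hmeas : Measurable (fun u : ℝ ↦ Real.exp (-u)) := Real.measurable_exp.comp measurable_neg
  refine ⟨hmeas, Measure.ext fun A hA ↦ ?_⟩
  rw [Measure.map_apply hmeas hA, expNegMeasure, withDensity_apply _ (hmeas hA),
    Measure.restrict_apply hA]
  -- `vol (A ∩ (0,∞)) = ∫⁻_{(0,∞)} 𝟙_A = ∫⁻_ℝ e^{−u} 𝟙_A(e^{−u}) du`
  have hcv := lintegral_image_eq_lintegral_abs_deriv_mul MeasurableSet.univ hasDerivWithinAt_exp_neg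
    injOn_exp_neg (A.indicator 1)
  rw [image_exp_neg_univ, Measure.restrict_univ] at hcv
  have h1 : ∫⁻ x in Ioi (0:ℝ), A.indicator (1 : ℝ → ℝ≥0∞) x = volume (A ∩ Ioi 0) := by
    rw [lintegral_indicator hA]
    simp only [Pi.one_apply, setLIntegral_one, Measure.restrict_apply hA]
  have h2 : ∫⁻ x : ℝ, ENNReal.ofReal |(-rexp (-x))| * A.indicator 1 ((rexp ∘ Neg.neg) x) =
      ∫⁻ x in (fun u : ℝ ↦ Real.exp (-u)) ⁻¹' A, ENNReal.ofReal (Real.exp (-x)) := by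
    rw [← lintegral_indicator (hmeas hA)]
    refine lintegral_congr fun u ↦ ?_
    by_cases h : Real.exp (-u) ∈ A
    · rw [Set.indicator_of_mem (show (rexp ∘ Neg.neg) u ∈ A from h),
        Set.indicator_of_mem (show u ∈ (fun u : ℝ ↦ Real.exp (-u)) ⁻¹' A from h), Pi.one_apply,
        mul_one, abs_neg, abs_of_pos (Real.exp_pos _)]
    · rw [Set.indicator_of_notMem (show (rexp ∘ Neg.neg) u ∉ A from h),
        Set.indicator_of_notMem (show u ∉ (fun u : ℝ ↦ Real.exp (-u)) ⁻¹' A from h), mul_zero]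
  rw [← h2, ← hcv, h1]

/-- The inverse substitution `u = −log t`: measure preserving from `((0,∞), dt)` onto `(ℝ, e^{−u}du)`.
[cite: Burnol2004b, §1 p. 4 (arXiv:math/0203120v7, TeX l.350–355) and §4 (TeX l.633–638)] -/
theorem measurePreserving_neg_log :
    MeasurePreserving (fun t : ℝ ↦ -Real.log t) (volume.restrict (Ioi 0)) expNegMeasure := by
  have hmeas : Measurable (fun t : ℝ ↦ -Real.log t) := Real.measurable_log.neg
  refine ⟨hmeas, ?_⟩
  have h := measurePreserving_exp_neg
  have hid : (fun t : ℝ ↦ -Real.log t) ∘ (fun u : ℝ ↦ Real.exp (-u)) = id := by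
    funext u; simp
  calc Measure.map (fun t : ℝ ↦ -Real.log t) (volume.restrict (Ioi 0))
      = Measure.map (fun t : ℝ ↦ -Real.log t) (Measure.map (fun u : ℝ ↦ Real.exp (-u)) expNegMeasure) := by
        rw [h.map_eq]
    _ = Measure.map ((fun t : ℝ ↦ -Real.log t) ∘ (fun u : ℝ ↦ Real.exp (-u))) expNegMeasure :=
        Measure.map_map hmeas h.measurable
    _ = expNegMeasure := by rw [hid, Measure.map_id]

/-! ## Step 1: `L²((0,∞), dt) ≃ L²(ℝ, e^{−u}du)` by composition with `u ↦ e^{−u}` -/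

/-- `f ↦ f ∘ (u ↦ e^{−u})` as a linear isometry `L²((0,∞),dt) → L²(ℝ, e^{−u}du)`. [cite: Burnol2004b, §1 p. 4 (arXiv:math/0203120v7, TeX l.350–355) and §4 (TeX l.633–638)] -/
def compExpNegFwd : Lp ℂ 2 (volume.restrict (Ioi (0:ℝ))) →ₗᵢ[ℂ] Lp ℂ 2 expNegMeasure :=
  Lp.compMeasurePreservingₗᵢ ℂ (fun u : ℝ ↦ Real.exp (-u)) measurePreserving_exp_neg

/-- `h ↦ h ∘ (t ↦ −log t)` as a linear isometry `L²(ℝ, e^{−u}du) → L²((0,∞),dt)`. [cite: Burnol2004b, §1 p. 4 (arXiv:math/0203120v7, TeX l.350–355) and §4 (TeX l.633–638)] -/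
def compExpNegBwd : Lp ℂ 2 expNegMeasure →ₗᵢ[ℂ] Lp ℂ 2 (volume.restrict (Ioi (0:ℝ))) :=
  Lp.compMeasurePreservingₗᵢ ℂ (fun t : ℝ ↦ -Real.log t) measurePreserving_neg_log

/-- The a.e. formula `(f ∘ e^{−·})(u) = f(e^{−u})` (`e^{−u}du`-a.e.). [cite: Burnol2004b, §1 p. 4 (arXiv:math/0203120v7, TeX l.350–355) and §4 (TeX l.633–638)] -/
theorem coeFn_compExpNegFwd (f : Lp ℂ 2 (volume.restrict (Ioi (0:ℝ)))) :
    compExpNegFwd f =ᵐ[expNegMeasure] fun u ↦ f (Real.exp (-u)) :=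
  Lp.coeFn_compMeasurePreserving f measurePreserving_exp_neg

/-- The a.e. formula `(h ∘ (−log))(t) = h(−log t)` (a.e. on `(0,∞)`). [cite: Burnol2004b, §1 p. 4 (arXiv:math/0203120v7, TeX l.350–355) and §4 (TeX l.633–638)] -/
theorem coeFn_compExpNegBwd (h : Lp ℂ 2 expNegMeasure) :
    compExpNegBwd h =ᵐ[volume.restrict (Ioi (0:ℝ))] fun t ↦ h (-Real.log t) :=
  Lp.coeFn_compMeasurePreserving h measurePreserving_neg_log

/-- Plumbing for the weight isometries (a.e. bookkeeping). [folklore] -/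
private theorem compExpNegBwd_compExpNegFwd (f : Lp ℂ 2 (volume.restrict (Ioi (0:ℝ)))) :
    compExpNegBwd (compExpNegFwd f) = f := by
  apply Lp.ext
  have h1 := coeFn_compExpNegBwd (compExpNegFwd f)
  -- transport the a.e. formula for `compExpNegFwd f` along `t ↦ −log t`
  have h2 := measurePreserving_neg_log.quasiMeasurePreserving.ae_eq_comp (coeFn_compExpNegFwd f)
  filter_upwards [h1, h2, ae_restrict_mem measurableSet_Ioi] with t ht1 ht2 ht
  rw [ht1]
  simp only [Function.comp_apply] at ht2
  rw [ht2, neg_neg, Real.exp_log ht]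

/-- Plumbing for the weight isometries (a.e. bookkeeping). [folklore] -/
private theorem compExpNegFwd_compExpNegBwd (h : Lp ℂ 2 expNegMeasure) :
    compExpNegFwd (compExpNegBwd h) = h := by
  apply Lp.ext
  have h1 := coeFn_compExpNegFwd (compExpNegBwd h)
  have h2 := measurePreserving_exp_neg.quasiMeasurePreserving.ae_eq_comp (coeFn_compExpNegBwd h)
  filter_upwards [h1, h2] with u hu1 hu2
  rw [hu1]
  simp only [Function.comp_apply] at hu2
  rw [hu2, Real.log_exp, neg_neg]

/-- **`L²((0,∞), dt) ≃ₗᵢ L²(ℝ, e^{−u}du)`**, `f ↦ (u ↦ f(e^{−u}))`, with inverse `h ↦ (t ↦ h(−log t))`.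
[cite: Burnol2004b, §1 p. 4 (arXiv:math/0203120v7, TeX l.350–355) and §4 (TeX l.633–638)] -/
def compExpNeg : Lp ℂ 2 (volume.restrict (Ioi (0:ℝ))) ≃ₗᵢ[ℂ] Lp ℂ 2 expNegMeasure :=
  LinearIsometryEquiv.ofSurjective compExpNegFwd
    fun h ↦ ⟨compExpNegBwd h, compExpNegFwd_compExpNegBwd h⟩

/-- `compExpNeg` is `compExpNegFwd` as a map. [cite: Burnol2004b, §1 p. 4 (arXiv:math/0203120v7, TeX l.350–355) and §4 (TeX l.633–638)] -/
@[simp] theorem compExpNeg_apply (f : Lp ℂ 2 (volume.restrict (Ioi (0:ℝ)))) :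
    compExpNeg f = compExpNegFwd f :=
  rfl

/-- `compExpNeg.symm` is `compExpNegBwd` as a map. [cite: Burnol2004b, §1 p. 4 (arXiv:math/0203120v7, TeX l.350–355) and §4 (TeX l.633–638)] -/
@[simp] theorem compExpNeg_symm_apply (h : Lp ℂ 2 expNegMeasure) :
    compExpNeg.symm h = compExpNegBwd h := by
  apply compExpNeg.injective
  rw [LinearIsometryEquiv.apply_symm_apply, compExpNeg_apply, compExpNegFwd_compExpNegBwd]

/-- The a.e. formula: `(compExpNeg f)(u) = f(e^{−u})` for Lebesgue-a.e. `u` (equivalently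
`e^{−u}du`-a.e.). [cite: Burnol2004b, §1 p. 4 (arXiv:math/0203120v7, TeX l.350–355) and §4 (TeX l.633–638)] -/
theorem coeFn_compExpNeg (f : Lp ℂ 2 (volume.restrict (Ioi (0:ℝ)))) :
    compExpNeg f =ᵐ[volume] fun u ↦ f (Real.exp (-u)) := by
  rw [compExpNeg_apply]
  exact ae_eq_expNegMeasure_iff.1 (coeFn_compExpNegFwd f)

/-- The a.e. formula for the inverse: `(compExpNeg⁻¹ h)(t) = h(−log t)` for a.e. `t > 0`. [cite: Burnol2004b, §1 p. 4 (arXiv:math/0203120v7, TeX l.350–355) and §4 (TeX l.633–638)] -/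
theorem coeFn_compExpNeg_symm (h : Lp ℂ 2 expNegMeasure) :
    compExpNeg.symm h =ᵐ[volume.restrict (Ioi (0:ℝ))] fun t ↦ h (-Real.log t) := by
  rw [compExpNeg_symm_apply]
  exact coeFn_compExpNegBwd h

/-! ## Step 2: `L²(ℝ, e^{−u}du) ≃ L²(ℝ, du)` by the weight `e^{−u/2}` -/

/-- `‖e^{−u/2}·z‖ₑ² = e^{−u}·‖z‖ₑ²`. [cite: Burnol2004b, §1 p. 4 (arXiv:math/0203120v7, TeX l.350–355) and §4 (TeX l.633–638)] -/
theorem enorm_sq_weight_mul (u : ℝ) (z : ℂ) :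
    ‖((Real.exp (-(u / 2)) : ℝ) : ℂ) * z‖ₑ ^ (2:ℝ) = ENNReal.ofReal (Real.exp (-u)) * ‖z‖ₑ ^ (2:ℝ) := by
  rw [enorm_mul, ENNReal.mul_rpow_of_nonneg _ _ (by norm_num : (0:ℝ) ≤ 2)]
  congr 1
  have h0 : 0 ≤ Real.exp (-(u / 2)) := (Real.exp_pos _).le
  rw [show ‖((Real.exp (-(u / 2)) : ℝ) : ℂ)‖ₑ = ‖Real.exp (-(u / 2))‖ₑ from by
      rw [enorm_eq_nnnorm, enorm_eq_nnnorm, Complex.nnnorm_real],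
    Real.enorm_eq_ofReal h0, ENNReal.rpow_two, ← ENNReal.ofReal_pow h0]
  congr 1
  rw [sq, ← Real.exp_add]
  congr 1
  ring

/-- `‖e^{u/2}·z‖ₑ²·e^{−u} = ‖z‖ₑ²`. [cite: Burnol2004b, §1 p. 4 (arXiv:math/0203120v7, TeX l.350–355) and §4 (TeX l.633–638)] -/
theorem weight_mul_enorm_sq_invWeight_mul (u : ℝ) (z : ℂ) :
    ENNReal.ofReal (Real.exp (-u)) * ‖((Real.exp (u / 2) : ℝ) : ℂ) * z‖ₑ ^ (2:ℝ) = ‖z‖ₑ ^ (2:ℝ) := by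
  rw [enorm_mul, ENNReal.mul_rpow_of_nonneg _ _ (by norm_num : (0:ℝ) ≤ 2), ← mul_assoc]
  have h0 : 0 ≤ Real.exp (u / 2) := (Real.exp_pos _).le
  rw [show ‖((Real.exp (u / 2) : ℝ) : ℂ)‖ₑ = ‖Real.exp (u / 2)‖ₑ from by
      rw [enorm_eq_nnnorm, enorm_eq_nnnorm, Complex.nnnorm_real],
    Real.enorm_eq_ofReal h0, ENNReal.rpow_two, ← ENNReal.ofReal_pow h0,
    ← ENNReal.ofReal_mul (Real.exp_pos _).le]
  have h1 : Real.exp (-u) * Real.exp (u / 2) ^ 2 = 1 := by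
    rw [sq, ← Real.exp_add, ← Real.exp_add, ← Real.exp_zero]
    congr 1; ring
  rw [h1, ENNReal.ofReal_one, one_mul]

/-- The `L²` norms match: `∫ |e^{−u/2} g(u)|² du = ∫ |g(u)|² e^{−u} du`. [cite: Burnol2004b, §1 p. 4 (arXiv:math/0203120v7, TeX l.350–355) and §4 (TeX l.633–638)] -/
theorem lintegral_weight_mul (g : ℝ → ℂ) :
    ∫⁻ u, ‖((Real.exp (-(u / 2)) : ℝ) : ℂ) * g u‖ₑ ^ (2:ℝ) ∂volume = ∫⁻ u, ‖g u‖ₑ ^ (2:ℝ) ∂expNegMeasure := by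
  rw [expNegMeasure, lintegral_withDensity_eq_lintegral_mul_non_measurable₀ _ measurable_density.aemeasurable
    (Eventually.of_forall fun _ ↦ ENNReal.ofReal_lt_top)]
  exact lintegral_congr fun u ↦ enorm_sq_weight_mul u (g u)

/-- The `L²` norms match (inverse weight): `∫ |e^{u/2} g(u)|² e^{−u} du = ∫ |g(u)|² du`. [cite: Burnol2004b, §1 p. 4 (arXiv:math/0203120v7, TeX l.350–355) and §4 (TeX l.633–638)] -/
theorem lintegral_invWeight_mul (g : ℝ → ℂ) :
    ∫⁻ u, ‖((Real.exp (u / 2) : ℝ) : ℂ) * g u‖ₑ ^ (2:ℝ) ∂expNegMeasure = ∫⁻ u, ‖g u‖ₑ ^ (2:ℝ) ∂volume := by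
  rw [expNegMeasure, lintegral_withDensity_eq_lintegral_mul_non_measurable₀ _ measurable_density.aemeasurable
    (Eventually.of_forall fun _ ↦ ENNReal.ofReal_lt_top)]
  exact lintegral_congr fun u ↦ weight_mul_enorm_sq_invWeight_mul u (g u)

/-- `‖e^{−u/2}·g‖_{L²(du)} = ‖g‖_{L²(e^{−u}du)}`. [cite: Burnol2004b, §1 p. 4 (arXiv:math/0203120v7, TeX l.350–355) and §4 (TeX l.633–638)] -/
theorem eLpNorm_weight_mul (g : ℝ → ℂ) :
    eLpNorm (fun u ↦ ((Real.exp (-(u / 2)) : ℝ) : ℂ) * g u) 2 volume = eLpNorm g 2 expNegMeasure := by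
  rw [eLpNorm_eq_lintegral_rpow_enorm_toReal two_ne_zero ENNReal.ofNat_ne_top,
    eLpNorm_eq_lintegral_rpow_enorm_toReal two_ne_zero ENNReal.ofNat_ne_top, ENNReal.toReal_ofNat,
    lintegral_weight_mul]

/-- `‖e^{u/2}·g‖_{L²(e^{−u}du)} = ‖g‖_{L²(du)}`. [cite: Burnol2004b, §1 p. 4 (arXiv:math/0203120v7, TeX l.350–355) and §4 (TeX l.633–638)] -/
theorem eLpNorm_invWeight_mul (g : ℝ → ℂ) :
    eLpNorm (fun u ↦ ((Real.exp (u / 2) : ℝ) : ℂ) * g u) 2 expNegMeasure = eLpNorm g 2 volume := by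
  rw [eLpNorm_eq_lintegral_rpow_enorm_toReal two_ne_zero ENNReal.ofNat_ne_top,
    eLpNorm_eq_lintegral_rpow_enorm_toReal two_ne_zero ENNReal.ofNat_ne_top, ENNReal.toReal_ofNat,
    lintegral_invWeight_mul]

/-- `e^{−u/2}·h ∈ L²(du)` for `h ∈ L²(e^{−u}du)`. [cite: Burnol2004b, §1 p. 4 (arXiv:math/0203120v7, TeX l.350–355) and §4 (TeX l.633–638)] -/
theorem memLp_weight_mul (h : Lp ℂ 2 expNegMeasure) :
    MemLp (fun u ↦ ((Real.exp (-(u / 2)) : ℝ) : ℂ) * h u) 2 volume := by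
  refine ⟨?_, ?_⟩
  · exact ((Complex.continuous_ofReal.comp (Real.continuous_exp.comp (continuous_id.div_const 2).neg))
      |>.aestronglyMeasurable).mul
      ((Lp.aestronglyMeasurable h).mono_ac absolutelyContinuous_expNegMeasure)
  · rw [eLpNorm_weight_mul]
    exact Lp.eLpNorm_lt_top h

/-- `e^{u/2}·g ∈ L²(e^{−u}du)` for `g ∈ L²(du)`. [cite: Burnol2004b, §1 p. 4 (arXiv:math/0203120v7, TeX l.350–355) and §4 (TeX l.633–638)] -/
theorem memLp_invWeight_mul (g : Lp ℂ 2 (volume : Measure ℝ)) :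
    MemLp (fun u ↦ ((Real.exp (u / 2) : ℝ) : ℂ) * g u) 2 expNegMeasure := by
  refine ⟨?_, ?_⟩
  · exact ((Complex.continuous_ofReal.comp (Real.continuous_exp.comp (continuous_id.div_const 2)))
      |>.aestronglyMeasurable).mul
      ((Lp.aestronglyMeasurable g).mono_ac expNegMeasure_absolutelyContinuous)
  · rw [eLpNorm_invWeight_mul]
    exact Lp.eLpNorm_lt_top g

/-- The forward weight map on representatives: `h ↦ [e^{−u/2}·h] ∈ L²(du)`. [cite: Burnol2004b, §1 p. 4 (arXiv:math/0203120v7, TeX l.350–355) and §4 (TeX l.633–638)] -/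
def expWeightFwdFun (h : Lp ℂ 2 expNegMeasure) : Lp ℂ 2 (volume : Measure ℝ) :=
  (memLp_weight_mul h).toLp _

/-- The backward weight map on representatives: `g ↦ [e^{u/2}·g] ∈ L²(e^{−u}du)`. [cite: Burnol2004b, §1 p. 4 (arXiv:math/0203120v7, TeX l.350–355) and §4 (TeX l.633–638)] -/
def expWeightBwdFun (g : Lp ℂ 2 (volume : Measure ℝ)) : Lp ℂ 2 expNegMeasure :=
  (memLp_invWeight_mul g).toLp _

/-- The a.e. formula `(e^{−u/2}·h)(u)`. [cite: Burnol2004b, §1 p. 4 (arXiv:math/0203120v7, TeX l.350–355) and §4 (TeX l.633–638)] -/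
theorem coeFn_expWeightFwdFun (h : Lp ℂ 2 expNegMeasure) :
    expWeightFwdFun h =ᵐ[volume] fun u ↦ ((Real.exp (-(u / 2)) : ℝ) : ℂ) * h u :=
  (memLp_weight_mul h).coeFn_toLp

/-- The a.e. formula `(e^{u/2}·g)(u)`. [cite: Burnol2004b, §1 p. 4 (arXiv:math/0203120v7, TeX l.350–355) and §4 (TeX l.633–638)] -/
theorem coeFn_expWeightBwdFun (g : Lp ℂ 2 (volume : Measure ℝ)) :
    expWeightBwdFun g =ᵐ[expNegMeasure] fun u ↦ ((Real.exp (u / 2) : ℝ) : ℂ) * g u :=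
  (memLp_invWeight_mul g).coeFn_toLp

/-- Plumbing for the weight isometries (a.e. bookkeeping). [folklore] -/
private theorem norm_expWeightFwdFun (h : Lp ℂ 2 expNegMeasure) : ‖expWeightFwdFun h‖ = ‖h‖ := by
  rw [expWeightFwdFun, Lp.norm_toLp, eLpNorm_weight_mul, Lp.norm_def]

/-- Plumbing for the weight isometries (a.e. bookkeeping). [folklore] -/
private theorem norm_expWeightBwdFun (g : Lp ℂ 2 (volume : Measure ℝ)) : ‖expWeightBwdFun g‖ = ‖g‖ := by
  rw [expWeightBwdFun, Lp.norm_toLp, eLpNorm_invWeight_mul, Lp.norm_def]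

/-- Plumbing for the weight isometries (a.e. bookkeeping). [folklore] -/
private theorem expWeightFwdFun_add (h h' : Lp ℂ 2 expNegMeasure) :
    expWeightFwdFun (h + h') = expWeightFwdFun h + expWeightFwdFun h' := by
  apply Lp.ext
  have ha := ae_eq_expNegMeasure_iff.1 (Lp.coeFn_add h h')
  filter_upwards [coeFn_expWeightFwdFun (h + h'), coeFn_expWeightFwdFun h, coeFn_expWeightFwdFun h',
    Lp.coeFn_add (expWeightFwdFun h) (expWeightFwdFun h'), ha] with u h1 h2 h3 h4 h5
  rw [h1, h4, Pi.add_apply, h2, h3, h5, Pi.add_apply, mul_add]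

/-- Plumbing for the weight isometries (a.e. bookkeeping). [folklore] -/
private theorem expWeightFwdFun_smul (c : ℂ) (h : Lp ℂ 2 expNegMeasure) :
    expWeightFwdFun (c • h) = c • expWeightFwdFun h := by
  apply Lp.ext
  have ha := ae_eq_expNegMeasure_iff.1 (Lp.coeFn_smul c h)
  filter_upwards [coeFn_expWeightFwdFun (c • h), coeFn_expWeightFwdFun h,
    Lp.coeFn_smul c (expWeightFwdFun h), ha] with u h1 h2 h4 h5
  rw [h1, h4, Pi.smul_apply, h2, h5, Pi.smul_apply, smul_eq_mul, smul_eq_mul]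
  ring

/-- Plumbing for the weight isometries (a.e. bookkeeping). [folklore] -/
private theorem expWeightBwdFun_add (g g' : Lp ℂ 2 (volume : Measure ℝ)) :
    expWeightBwdFun (g + g') = expWeightBwdFun g + expWeightBwdFun g' := by
  apply Lp.ext
  have ha := expNegMeasure_absolutelyContinuous.ae_eq (Lp.coeFn_add g g')
  filter_upwards [coeFn_expWeightBwdFun (g + g'), coeFn_expWeightBwdFun g, coeFn_expWeightBwdFun g',
    Lp.coeFn_add (expWeightBwdFun g) (expWeightBwdFun g'), ha] with u h1 h2 h3 h4 h5
  rw [h1, h4, Pi.add_apply, h2, h3, h5, Pi.add_apply, mul_add]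

/-- Plumbing for the weight isometries (a.e. bookkeeping). [folklore] -/
private theorem expWeightBwdFun_smul (c : ℂ) (g : Lp ℂ 2 (volume : Measure ℝ)) :
    expWeightBwdFun (c • g) = c • expWeightBwdFun g := by
  apply Lp.ext
  have ha := expNegMeasure_absolutelyContinuous.ae_eq (Lp.coeFn_smul c g)
  filter_upwards [coeFn_expWeightBwdFun (c • g), coeFn_expWeightBwdFun g,
    Lp.coeFn_smul c (expWeightBwdFun g), ha] with u h1 h2 h4 h5
  rw [h1, h4, Pi.smul_apply, h2, h5, Pi.smul_apply, smul_eq_mul, smul_eq_mul]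
  ring

/-- `h ↦ e^{−u/2}·h` as a linear isometry `L²(e^{−u}du) → L²(du)`. [cite: Burnol2004b, §1 p. 4 (arXiv:math/0203120v7, TeX l.350–355) and §4 (TeX l.633–638)] -/
def expWeightFwd : Lp ℂ 2 expNegMeasure →ₗᵢ[ℂ] Lp ℂ 2 (volume : Measure ℝ) where
  toFun := expWeightFwdFun
  map_add' := expWeightFwdFun_add
  map_smul' := expWeightFwdFun_smul
  norm_map' := norm_expWeightFwdFun

/-- `g ↦ e^{u/2}·g` as a linear isometry `L²(du) → L²(e^{−u}du)`. [cite: Burnol2004b, §1 p. 4 (arXiv:math/0203120v7, TeX l.350–355) and §4 (TeX l.633–638)] -/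
def expWeightBwd : Lp ℂ 2 (volume : Measure ℝ) →ₗᵢ[ℂ] Lp ℂ 2 expNegMeasure where
  toFun := expWeightBwdFun
  map_add' := expWeightBwdFun_add
  map_smul' := expWeightBwdFun_smul
  norm_map' := norm_expWeightBwdFun

/-- `expWeightFwd` is `expWeightFwdFun` as a map. [cite: Burnol2004b, §1 p. 4 (arXiv:math/0203120v7, TeX l.350–355) and §4 (TeX l.633–638)] -/
@[simp] theorem expWeightFwd_apply (h : Lp ℂ 2 expNegMeasure) : expWeightFwd h = expWeightFwdFun h := rfl

/-- `expWeightBwd` is `expWeightBwdFun` as a map. [cite: Burnol2004b, §1 p. 4 (arXiv:math/0203120v7, TeX l.350–355) and §4 (TeX l.633–638)] -/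
@[simp] theorem expWeightBwd_apply (g : Lp ℂ 2 (volume : Measure ℝ)) :
    expWeightBwd g = expWeightBwdFun g := rfl

/-- Plumbing for the weight isometries (a.e. bookkeeping). [folklore] -/
private theorem expWeightFwdFun_expWeightBwdFun (g : Lp ℂ 2 (volume : Measure ℝ)) :
    expWeightFwdFun (expWeightBwdFun g) = g := by
  apply Lp.ext
  have h1 := coeFn_expWeightFwdFun (expWeightBwdFun g)
  have h2 := ae_eq_expNegMeasure_iff.1 (coeFn_expWeightBwdFun g)
  filter_upwards [h1, h2] with u hu1 hu2
  rw [hu1, hu2, ← mul_assoc, ← Complex.ofReal_mul, ← Real.exp_add,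
    show -(u / 2) + u / 2 = 0 by ring, Real.exp_zero, Complex.ofReal_one, one_mul]

/-- Plumbing for the weight isometries (a.e. bookkeeping). [folklore] -/
private theorem expWeightBwdFun_expWeightFwdFun (h : Lp ℂ 2 expNegMeasure) :
    expWeightBwdFun (expWeightFwdFun h) = h := by
  apply Lp.ext
  have h1 := coeFn_expWeightBwdFun (expWeightFwdFun h)
  have h3 := ae_eq_expNegMeasure_iff.2 (coeFn_expWeightFwdFun h)
  filter_upwards [h1, h3] with u hu1 hu3
  rw [hu1, hu3, ← mul_assoc, ← Complex.ofReal_mul, ← Real.exp_add,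
    show u / 2 + -(u / 2) = 0 by ring, Real.exp_zero, Complex.ofReal_one, one_mul]

/-- **`L²(ℝ, e^{−u}du) ≃ₗᵢ L²(ℝ, du)`**, `h ↦ e^{−u/2}·h`, with inverse `g ↦ e^{u/2}·g`. [cite: Burnol2004b, §1 p. 4 (arXiv:math/0203120v7, TeX l.350–355) and §4 (TeX l.633–638)] -/
def expWeight : Lp ℂ 2 expNegMeasure ≃ₗᵢ[ℂ] Lp ℂ 2 (volume : Measure ℝ) :=
  LinearIsometryEquiv.ofSurjective expWeightFwd
    fun g ↦ ⟨expWeightBwdFun g, expWeightFwdFun_expWeightBwdFun g⟩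

/-- `expWeight` is `expWeightFwdFun` as a map. [cite: Burnol2004b, §1 p. 4 (arXiv:math/0203120v7, TeX l.350–355) and §4 (TeX l.633–638)] -/
@[simp] theorem expWeight_apply (h : Lp ℂ 2 expNegMeasure) : expWeight h = expWeightFwdFun h := rfl

/-- `expWeight.symm` is `expWeightBwdFun` as a map. [cite: Burnol2004b, §1 p. 4 (arXiv:math/0203120v7, TeX l.350–355) and §4 (TeX l.633–638)] -/
@[simp] theorem expWeight_symm_apply (g : Lp ℂ 2 (volume : Measure ℝ)) :
    expWeight.symm g = expWeightBwdFun g := by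
  apply expWeight.injective
  rw [LinearIsometryEquiv.apply_symm_apply, expWeight_apply, expWeightFwdFun_expWeightBwdFun]

/-- The a.e. formula: `(expWeight h)(u) = e^{−u/2} h(u)`. [cite: Burnol2004b, §1 p. 4 (arXiv:math/0203120v7, TeX l.350–355) and §4 (TeX l.633–638)] -/
theorem coeFn_expWeight (h : Lp ℂ 2 expNegMeasure) :
    expWeight h =ᵐ[volume] fun u ↦ ((Real.exp (-(u / 2)) : ℝ) : ℂ) * h u :=
  coeFn_expWeightFwdFun h

/-- The a.e. formula for the inverse: `(expWeight⁻¹ g)(u) = e^{u/2} g(u)`. [cite: Burnol2004b, §1 p. 4 (arXiv:math/0203120v7, TeX l.350–355) and §4 (TeX l.633–638)] -/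
theorem coeFn_expWeight_symm (g : Lp ℂ 2 (volume : Measure ℝ)) :
    expWeight.symm g =ᵐ[volume] fun u ↦ ((Real.exp (u / 2) : ℝ) : ℂ) * g u := by
  rw [expWeight_symm_apply]
  exact ae_eq_expNegMeasure_iff.1 (coeFn_expWeightBwdFun g)

/-! ## Step 3: the transport `L²((0,∞),dt) ≃ L²(ℝ,du)` and the Mellin–Plancherel transform -/

/-- **The transport `U : L²((0,∞), dt) ≃ₗᵢ L²(ℝ, du)`, `(Uf)(u) = e^{−u/2} f(e^{−u})`.** [cite: Burnol2004b, §1 p. 4 (arXiv:math/0203120v7, TeX l.350–355) and §4 (TeX l.633–638)] -/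
def expTransport : Lp ℂ 2 (volume.restrict (Ioi (0:ℝ))) ≃ₗᵢ[ℂ] Lp ℂ 2 (volume : Measure ℝ) :=
  compExpNeg.trans expWeight

/-- The a.e. formula `(Uf)(u) = e^{−u/2} f(e^{−u})`. [cite: Burnol2004b, §1 p. 4 (arXiv:math/0203120v7, TeX l.350–355) and §4 (TeX l.633–638)] -/
theorem coeFn_expTransport (f : Lp ℂ 2 (volume.restrict (Ioi (0:ℝ)))) :
    expTransport f =ᵐ[volume] fun u ↦ ((Real.exp (-(u / 2)) : ℝ) : ℂ) * f (Real.exp (-u)) := by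
  have h1 := coeFn_expWeight (compExpNeg f)
  have h2 := coeFn_compExpNeg f
  filter_upwards [h1, h2] with u hu1 hu2
  rw [expTransport, LinearIsometryEquiv.trans_apply, hu1, hu2]

/-- Composition with `u ↦ e^{−u}` respects Lebesgue-a.e. equality on `(0, ∞)`. [cite: Burnol2004b, §1 p. 4 (arXiv:math/0203120v7, TeX l.350–355) and §4 (TeX l.633–638)] -/
theorem comp_exp_neg_ae_eq {f g : ℝ → ℂ} (h : f =ᵐ[volume.restrict (Ioi (0:ℝ))] g) :
    (fun u : ℝ ↦ f (Real.exp (-u))) =ᵐ[volume] fun u ↦ g (Real.exp (-u)) :=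
  ae_eq_expNegMeasure_iff.1 (measurePreserving_exp_neg.quasiMeasurePreserving.ae_eq_comp h)

/-- The transport of a representative: for `f ∈ L²(0,∞)`, `U[f] = [u ↦ e^{−u/2} f(e^{−u})]`, i.e. the
function `G(u) = e^{−u/2} f(e^{−u})` of Mathlib's `mellin_eq_fourier` (at `Re s = ½`) is square
integrable and its class is `expTransport f`. [cite: Burnol2004b, §1 p. 4 (arXiv:math/0203120v7, TeX l.350–355) and §4 (TeX l.633–638)] -/
theorem coeFn_expTransport_toLp {f : ℝ → ℂ} (hf : MemLp f 2 (volume.restrict (Ioi (0:ℝ)))) :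
    expTransport (hf.toLp f) =ᵐ[volume]
      fun u ↦ (Real.exp (-(1 / 2 : ℝ) * u)) • f (Real.exp (-u)) := by
  have h1 := coeFn_expTransport (hf.toLp f)
  have h2 := comp_exp_neg_ae_eq hf.coeFn_toLp
  filter_upwards [h1, h2] with u hu1 hu2
  rw [hu1, hu2, Complex.real_smul]
  congr 2
  ring

/-- **The Mellin–Plancherel transform** `𝓜 : L²((0,∞), dt) ≃ₗᵢ L²(ℝ, dξ)`: the `L²` Fourier transform
of the transport `U`, i.e. the unitary extension of `f ↦ (ξ ↦ ∫₀^∞ f(t) t^{−1/2 + 2πiξ} dt)`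
(`= 𝓜f(½ + 2πiξ)`, Mathlib's `mellin`; `= f̂(½ − 2πiξ)` for Burnol's right Mellin transform
`f̂(s) = ∫₀^∞ f(t)t^{−s}dt`).  Titchmarsh, *Fourier Integrals*, Thm. 71, in the parametrisation
`s = ½ + 2πiξ` of the critical line. [cite: Burnol2004b, §1 p. 4 (arXiv:math/0203120v7, TeX l.350–355)] -/
def mellinL2 : Lp ℂ 2 (volume.restrict (Ioi (0:ℝ))) ≃ₗᵢ[ℂ] Lp ℂ 2 (volume : Measure ℝ) :=
  expTransport.trans (Lp.fourierTransformₗᵢ ℝ ℂ)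

/-- `𝓜 = 𝓕 ∘ U`: the Mellin–Plancherel transform is the `L²` Fourier transform (Mathlib `Lp.fourierTransformₗᵢ`, notation `𝓕`) of the transport `U = expTransport`. [cite: Burnol2004b, §1 p. 4 (arXiv:math/0203120v7, TeX l.350–355) and §4 (TeX l.633–638)] -/
theorem mellinL2_apply (f : Lp ℂ 2 (volume.restrict (Ioi (0:ℝ)))) :
    mellinL2 f = (𝓕 (expTransport f) : Lp ℂ 2 (volume : Measure ℝ)) :=
  rfl

/-- **Plancherel**: `‖𝓜f‖ = ‖f‖`. [cite: Burnol2004b, §1 p. 4 (arXiv:math/0203120v7, TeX l.350–355)] -/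
theorem norm_mellinL2 (f : Lp ℂ 2 (volume.restrict (Ioi (0:ℝ)))) : ‖mellinL2 f‖ = ‖f‖ :=
  mellinL2.norm_map f

/-- `𝓜` is onto `L²(ℝ)` (it is a linear isometry EQUIVALENCE; the inverse is `mellinL2.symm`).
[cite: Burnol2004b, §1 p. 4 (arXiv:math/0203120v7, TeX l.350–355)] -/
theorem mellinL2_surjective : Function.Surjective mellinL2 :=
  mellinL2.surjective

/-- The integrand of `mellin_eq_fourier` at `Re s = ½` is integrable when the Mellin transform
converges absolutely there. [cite: Burnol2004b, §1 p. 4 (arXiv:math/0203120v7, TeX l.350–355) and §4 (TeX l.633–638)] -/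
theorem integrable_expTransportFun {f : ℝ → ℂ} (hf : MellinConvergent f (1 / 2 : ℂ)) :
    Integrable fun u : ℝ ↦ (Real.exp (-(1 / 2 : ℝ) * u)) • f (Real.exp (-u)) := by
  have h := (integrableOn_Ioi_iff_integrable_exp_neg_smul _).1 hf
  refine h.congr (Eventually.of_forall fun u ↦ ?_)
  have hpos : 0 < Real.exp (-u) := Real.exp_pos _
  dsimp only
  rw [show (1 / 2 : ℂ) - 1 = (((1 / 2 : ℝ) - 1 : ℝ) : ℂ) by push_cast; ring, ← ofReal_cpow hpos.le,
    Complex.coe_smul, smul_smul, exp_neg_mul_exp_neg_rpow]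

/-- **The dictionary** (`L¹(t^{−1/2}dt) ∩ L²`): if `f ∈ L²(0,∞)` and its Mellin transform converges
absolutely on the critical line (`MellinConvergent f ½`), then `𝓜f` IS the Mellin transform there:
`(mellinL2 f)(ξ) = 𝓜f(½ + 2πiξ) = ∫₀^∞ f(t) t^{−1/2+2πiξ} dt` for a.e. `ξ`. [cite: Burnol2004b, §1 p. 4 (arXiv:math/0203120v7, TeX l.350–355)] -/
theorem mellinL2_toLp_ae_eq_mellin {f : ℝ → ℂ} (hf2 : MemLp f 2 (volume.restrict (Ioi (0:ℝ))))
    (hf1 : MellinConvergent f (1 / 2 : ℂ)) :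
    mellinL2 (hf2.toLp f) =ᵐ[volume] fun ξ : ℝ ↦ mellin f (1 / 2 + 2 * π * ξ * I) := by
  set G : ℝ → ℂ := fun u ↦ (Real.exp (-(1 / 2 : ℝ) * u)) • f (Real.exp (-u)) with hG
  have hG1 : Integrable G := integrable_expTransportFun hf1
  have hGae : (expTransport (hf2.toLp f) : ℝ → ℂ) =ᵐ[volume] G := coeFn_expTransport_toLp hf2
  have hG2 : MemLp G 2 (volume : Measure ℝ) := (Lp.memLp _).ae_eq hGae
  -- `U[f] = [G]` in `L²`
  have hUG : expTransport (hf2.toLp f) = hG2.toLp G :=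
    Lp.ext (hGae.trans hG2.coeFn_toLp.symm)
  rw [mellinL2_apply, hUG]
  refine (fourier_toLp_ae_eq_fourierIntegral hG1 hG2).trans (Eventually.of_forall fun ξ ↦ ?_)
  -- `𝓕G(ξ) = 𝓜f(½ + 2πiξ)`
  have h := mellin_eq_fourier f (s := 1 / 2 + 2 * π * ξ * I)
  have hre : (1 / 2 + 2 * π * ξ * I : ℂ).re = 1 / 2 := by simp
  have him : (1 / 2 + 2 * π * ξ * I : ℂ).im / (2 * π) = ξ := by
    have hπ : (π : ℝ) ≠ 0 := Real.pi_pos.ne'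
    simp only [add_im, mul_im, mul_re, ofReal_re, ofReal_im, I_re, I_im, re_ofNat, im_ofNat,
      one_div]
    field_simp
    simp
  rw [hre, him] at h
  exact h.symm

/-- `∫ ‖g‖² = ‖g‖²` for an `L²` class (real form of `⟪g, g⟫ = ‖g‖²`). [cite: Burnol2004b, §1 p. 4 (arXiv:math/0203120v7, TeX l.350–355) and §4 (TeX l.633–638)] -/
theorem integral_norm_sq_eq_norm_sq {α : Type*} [MeasurableSpace α] {μ : Measure α} (g : Lp ℂ 2 μ) :
    ∫ a, ‖(g : α → ℂ) a‖ ^ 2 ∂μ = ‖g‖ ^ 2 := by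
  have h1 : (inner ℂ g g) = ((‖g‖ : ℂ)) ^ 2 := inner_self_eq_norm_sq_to_K g
  rw [L2.inner_def] at h1
  have h2 : ∫ a, (inner ℂ ((g : α → ℂ) a) ((g : α → ℂ) a)) ∂μ = ((∫ a, ‖(g : α → ℂ) a‖ ^ 2 ∂μ : ℝ) : ℂ) := by
    rw [← integral_complex_ofReal]
    refine integral_congr_ae (Eventually.of_forall fun a ↦ ?_)
    show inner ℂ ((g : α → ℂ) a) ((g : α → ℂ) a) = (((‖(g : α → ℂ) a‖ ^ 2 : ℝ)) : ℂ)
    rw [inner_self_eq_norm_sq_to_K]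
    push_cast
    rfl
  apply Complex.ofReal_injective
  rw [← h2, h1]
  push_cast
  rfl

/-- **Parseval in `ξ`**: `∫_ℝ ‖(𝓜f)(ξ)‖² dξ = ∫₀^∞ ‖f(t)‖² dt` for every `f ∈ L²(0,∞)`.
(The `τ = 2πξ` form `∫_ℝ ‖𝓜f(½+iτ)‖² dτ = 2π∫₀^∞‖f‖²` for `f ∈ L¹(t^{−1/2}dt) ∩ L²` is the tree's
`integral_norm_sq_mellin_half_eq`.) [cite: Burnol2004b, §1 p. 4 (arXiv:math/0203120v7, TeX l.350–355)] -/
theorem integral_norm_sq_mellinL2 (f : Lp ℂ 2 (volume.restrict (Ioi (0:ℝ)))) :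
    ∫ ξ, ‖(mellinL2 f : ℝ → ℂ) ξ‖ ^ 2 = ∫ t in Ioi (0:ℝ), ‖(f : ℝ → ℂ) t‖ ^ 2 := by
  rw [integral_norm_sq_eq_norm_sq, norm_mellinL2, ← integral_norm_sq_eq_norm_sq f]

/-! ### Translations and phases on `L²(ℝ)`, dilations of `(0,∞)`, and the dilation law

Under `U` the dilation `f ↦ f(c·)` (`c > 0`) of `(0,∞)` is `c^{−1/2}` times the translation
`G ↦ G(· − log c)` of the line (`expTransport_eq_of_comp_mul`), and the `L²` Fourier transform turns
this translation into the phase `e^{−2πi(log c)ξ}` (`fourier_compSubRight`, by Schwartz density as in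
the tree's `L2FourierReflection.fourier_compNeg`); whence the **dilation law**
`𝓜(f(c·))(ξ) = c^{−(½+2πiξ)}·𝓜f(ξ)` a.e. (`mellinL2_ae_eq_of_comp_mul`) — the `L²`-operator form of
Mathlib's function-level `mellin_comp_mul_left`, i.e. Burnol's «the composite `𝓕₊·I` is scale
invariant hence diagonalized by the Mellin Transform» (§1 p. 4, TeX l.355–358). -/

/-- The phase `ξ ↦ e^{−2πiaξ}` is (continuous and) unimodular, hence in `L^∞(ℝ)`.
[cite: Grafakos2014, Prop. 2.2.11 (6), PDF p. 126] -/
theorem memLp_top_phase (a : ℝ) :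
    MemLp (fun ξ : ℝ ↦ Complex.exp (((-(2 * π * a * ξ) : ℝ) : ℂ) * I)) ∞ (volume : Measure ℝ) := by
  refine memLp_top_of_bound (Continuous.aestronglyMeasurable ?_) 1 (Eventually.of_forall fun ξ ↦ ?_)
  · exact Complex.continuous_exp.comp
      ((Complex.continuous_ofReal.comp (by fun_prop)).mul continuous_const)
  · rw [Complex.norm_exp_ofReal_mul_I]

/-- The a.e. formula for the `L^∞(ℝ)` class `[e^{−2πia·}] := (memLp_top_phase a).toLp _` of the phase
(it acts on `L²(ℝ)` through Mathlib's `HSMul (Lp ℂ ∞ μ) (Lp ℂ 2 μ) (Lp ℂ 2 μ)`,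
`MeasureTheory.Lp.coeFn_lpSMul`). [cite: Grafakos2014, Prop. 2.2.11 (6), PDF p. 126] -/
theorem coeFn_phase (a : ℝ) :
    (((memLp_top_phase a).toLp _ : Lp ℂ ∞ (volume : Measure ℝ)) : ℝ → ℂ) =ᵐ[volume]
      fun ξ : ℝ ↦ Complex.exp (((-(2 * π * a * ξ) : ℝ) : ℂ) * I) :=
  (memLp_top_phase a).coeFn_toLp

/-- Multiplication by a fixed `L^∞` function is continuous on `L²` (`‖φ•g‖ ≤ ‖φ‖‖g‖`).
[cite: Grafakos2014, §2.2.4, PDF pp. 129–130] -/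
theorem continuous_lpSMul {α : Type*} [MeasurableSpace α] {μ : Measure α} (φ : Lp ℂ ∞ μ) :
    Continuous fun g : Lp ℂ 2 μ ↦ (φ • g : Lp ℂ 2 μ) := by
  let T : Lp ℂ 2 μ →+ Lp ℂ 2 μ :=
    { toFun := fun g ↦ (φ • g : Lp ℂ 2 μ)
      map_zero' := Lp.smul_zero ℂ 2 φ
      map_add' := fun g₁ g₂ ↦ Lp.add_smul φ g₁ g₂ }
  exact AddMonoidHomClass.continuous_of_bound T ‖φ‖ fun g ↦ Lp.norm_smul_le φ g

/-- The translate `T_a u = u(· − a)` of an `L²(ℝ)` class (Mathlib `Lp.compMeasurePreserving` along the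
measure-preserving `x ↦ x − a`) is `u(· − a)` almost everywhere.
[cite: Grafakos2014, §2.2.2 eq. (2.2.13), PDF p. 126] -/
theorem coeFn_compSubRight (u : Lp ℂ 2 (volume : Measure ℝ)) (a : ℝ) :
    ((Lp.compMeasurePreserving (fun x : ℝ ↦ x - a) (measurePreserving_sub_right volume a) u :
        Lp ℂ 2 (volume : Measure ℝ)) : ℝ → ℂ) =ᵐ[volume] fun x ↦ (u : ℝ → ℂ) (x - a) :=
  Lp.coeFn_compMeasurePreserving u (measurePreserving_sub_right volume a)

/-- **`(τ^a f)^(w) = e^{−2πiaw} f̂(w)`** at function level: the Fourier integral of `x ↦ f(x − a)`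
(Mathlib `VectorFourier.fourierIntegral_comp_add_right`, rewritten in Mathlib's `𝓕` on `ℝ → ℂ`).
[cite: Grafakos2014, Prop. 2.2.11 (6), PDF p. 126] -/
theorem fourierIntegral_comp_sub_right (f : ℝ → ℂ) (a w : ℝ) :
    𝓕 (fun x : ℝ ↦ f (x - a)) w = Complex.exp (((-(2 * π * a * w) : ℝ) : ℂ) * I) * 𝓕 f w := by
  have h := congrFun (VectorFourier.fourierIntegral_comp_add_right 𝐞 (volume : Measure ℝ)
    (innerₗ ℝ) f (-a)) w
  have e : (f ∘ fun v : ℝ ↦ v + -a) = fun x : ℝ ↦ f (x - a) := by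
    funext v
    simp [sub_eq_add_neg]
  rw [e] at h
  -- `𝓕` on functions `ℝ → ℂ` is `VectorFourier.fourierIntegral 𝐞 volume (innerₗ ℝ)` by definition
  change VectorFourier.fourierIntegral 𝐞 volume (innerₗ ℝ) (fun x : ℝ ↦ f (x - a)) w =
    _ * VectorFourier.fourierIntegral 𝐞 volume (innerₗ ℝ) f w
  rw [h, Circle.smul_def, Real.fourierChar_apply, smul_eq_mul]
  have hs : (((2 * π * ((innerₗ ℝ) (-a) w) : ℝ)) : ℂ) = (((-(2 * π * a * w)) : ℝ) : ℂ) := by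
    congr 1
    simp only [innerₗ_apply_apply, RCLike.inner_apply, conj_trivial]
    ring
  rw [hs]

/-- The translate of (the `L²` class of) a Schwartz function is the class of `x ↦ φ(x − a)`.
[cite: Grafakos2014, §2.2.2 eq. (2.2.13), PDF p. 126] -/
theorem compSubRight_toLp_schwartz (φ : SchwartzMap ℝ ℂ) (a : ℝ) :
    Lp.compMeasurePreserving (fun x : ℝ ↦ x - a) (measurePreserving_sub_right volume a)
        (φ.toLp 2 (volume : Measure ℝ)) =
      ((φ.memLp 2 (volume : Measure ℝ)).comp_measurePreserving
        (measurePreserving_sub_right volume a)).toLp (⇑φ ∘ fun x : ℝ ↦ x - a) :=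
  Lp.toLp_compMeasurePreserving (φ.memLp 2 (volume : Measure ℝ))
    (measurePreserving_sub_right volume a)

/-- **`𝓕(T_a u) = e^{−2πia·} • 𝓕u` on `L²(ℝ)`**: the `L²` Fourier transform turns the translation
`u ↦ u(· − a)` into multiplication by the phase `e^{−2πiaξ}` (on Schwartz functions both sides are
`fourierIntegral_comp_sub_right`; both sides are continuous in `u` and Schwartz functions are dense
in `L²`). [cite: Grafakos2014, Prop. 2.2.11 (6), PDF p. 126; §2.2.4, PDF pp. 129–130] -/
theorem fourier_compSubRight (u : Lp ℂ 2 (volume : Measure ℝ)) (a : ℝ) :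
    (𝓕 (Lp.compMeasurePreserving (fun x : ℝ ↦ x - a) (measurePreserving_sub_right volume a) u) :
        Lp ℂ 2 (volume : Measure ℝ)) =
      (((memLp_top_phase a).toLp _ : Lp ℂ ∞ (volume : Measure ℝ)) •
        (𝓕 u : Lp ℂ 2 (volume : Measure ℝ)) : Lp ℂ 2 (volume : Measure ℝ)) := by
  have hT := measurePreserving_sub_right (volume : Measure ℝ) a
  have hTc : Continuous (Lp.compMeasurePreserving (fun x : ℝ ↦ x - a) hT :
      Lp ℂ 2 (volume : Measure ℝ) → Lp ℂ 2 (volume : Measure ℝ)) :=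
    (Lp.isometry_compMeasurePreserving hT).continuous
  have hd := SchwartzMap.denseRange_toLpCLM (E := ℝ) (F := ℂ) (p := 2) (μ := (volume : Measure ℝ))
    ENNReal.ofNat_ne_top
  refine congrFun (hd.equalizer
    ((continuous_fourier (E := Lp ℂ 2 (volume : Measure ℝ))).comp hTc)
    ((continuous_lpSMul ((memLp_top_phase a).toLp _ : Lp ℂ ∞ (volume : Measure ℝ))).comp
      (continuous_fourier (E := Lp ℂ 2 (volume : Measure ℝ)))) ?_) u
  funext φ
  simp only [Function.comp_apply, SchwartzMap.toLpCLM_apply]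
  have hint : Integrable (⇑φ ∘ fun x : ℝ ↦ x - a) (volume : Measure ℝ) :=
    hT.integrable_comp_of_integrable φ.integrable
  have hmem : MemLp (⇑φ ∘ fun x : ℝ ↦ x - a) 2 (volume : Measure ℝ) :=
    (φ.memLp 2 (volume : Measure ℝ)).comp_measurePreserving hT
  rw [compSubRight_toLp_schwartz, SchwartzMap.toLp_fourier_eq]
  apply Lp.ext
  filter_upwards [fourier_toLp_ae_eq_fourierIntegral hint hmem,
    Lp.coeFn_lpSMul (r := 2) ((memLp_top_phase a).toLp _ : Lp ℂ ∞ (volume : Measure ℝ))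
      ((𝓕 φ).toLp 2 (volume : Measure ℝ)), coeFn_phase a,
    (𝓕 φ).coeFn_toLp 2 (volume : Measure ℝ)] with w h1 h2 h3 h4
  rw [h1, h2, Pi.smul_apply', h3, h4, SchwartzMap.fourier_coe, Function.comp_def, smul_eq_mul]
  exact fourierIntegral_comp_sub_right φ a w

/-- **`𝓕v(ξ) = e^{−2πiaξ} 𝓕u(ξ)` a.e. whenever `v = u(· − a)` a.e.** (operator-free form of
`fourier_compSubRight`). [cite: Grafakos2014, Prop. 2.2.11 (6), PDF p. 126; §2.2.4, PDF pp. 129–130] -/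
theorem fourier_ae_eq_of_comp_sub_right {u v : Lp ℂ 2 (volume : Measure ℝ)} {a : ℝ}
    (h : (v : ℝ → ℂ) =ᵐ[volume] fun x ↦ (u : ℝ → ℂ) (x - a)) :
    ((𝓕 v : Lp ℂ 2 (volume : Measure ℝ)) : ℝ → ℂ) =ᵐ[volume]
      fun ξ ↦ Complex.exp (((-(2 * π * a * ξ) : ℝ) : ℂ) * I) *
        ((𝓕 u : Lp ℂ 2 (volume : Measure ℝ)) : ℝ → ℂ) ξ := by
  have hv : v = Lp.compMeasurePreserving (fun x : ℝ ↦ x - a) (measurePreserving_sub_right volume a) u :=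
    Lp.ext (h.trans (coeFn_compSubRight u a).symm)
  rw [hv, fourier_compSubRight u a]
  filter_upwards [Lp.coeFn_lpSMul (r := 2) ((memLp_top_phase a).toLp _ : Lp ℂ ∞ (volume : Measure ℝ))
      (𝓕 u : Lp ℂ 2 (volume : Measure ℝ)), coeFn_phase a] with ξ h1 h2
  rw [h1, Pi.smul_apply', h2, smul_eq_mul]

/-- **The dilation `t ↦ ct` (`c > 0`) of `(0,∞)`** maps `dt` on `(0,∞)` to `c⁻¹·dt` on `(0,∞)`.
[cite: Burnol2004b, §1 p. 4 (arXiv:math/0203120v7, TeX l.355–358)] -/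
theorem measurePreserving_mul_left_Ioi {c : ℝ} (hc : 0 < c) :
    MeasurePreserving (fun t : ℝ ↦ c * t) (volume.restrict (Ioi (0:ℝ)))
      ((ENNReal.ofReal c⁻¹) • volume.restrict (Ioi (0:ℝ))) := by
  have h0 : MeasurePreserving (fun t : ℝ ↦ c * t) volume (ENNReal.ofReal |c⁻¹| • volume) :=
    ⟨measurable_const_mul c, Real.map_volume_mul_left hc.ne'⟩
  have h := h0.restrict_preimage (measurableSet_Ioi (a := (0:ℝ)))
  rwa [Set.preimage_const_mul_Ioi₀ (0:ℝ) hc, zero_div, Measure.restrict_smul,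
    abs_of_pos (inv_pos.2 hc)] at h

/-- Dilations of `(0,∞)` respect a.e. equality: `f = g` a.e. on `(0,∞)` ⟹ `f(c·) = g(c·)` a.e. on
`(0,∞)` (`c > 0`). [cite: Burnol2004b, §1 p. 4 (arXiv:math/0203120v7, TeX l.355–358)] -/
theorem comp_mul_ae_eq_Ioi {f g : ℝ → ℂ} (h : f =ᵐ[volume.restrict (Ioi (0:ℝ))] g) {c : ℝ}
    (hc : 0 < c) :
    (fun t : ℝ ↦ f (c * t)) =ᵐ[volume.restrict (Ioi (0:ℝ))] fun t ↦ g (c * t) :=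
  ((measurePreserving_mul_left_Ioi hc).quasiMeasurePreserving.mono_right
    Measure.smul_absolutelyContinuous).ae_eq_comp h

/-- `Lᵖ(0,∞)` is stable under dilations: `f ∈ Lᵖ((0,∞)) ⟹ f(c·) ∈ Lᵖ((0,∞))` (`c > 0`).
[cite: Burnol2004b, §1 p. 4 (arXiv:math/0203120v7, TeX l.355–358)] -/
theorem memLp_comp_mul_Ioi {p : ℝ≥0∞} {f : ℝ → ℂ} (hf : MemLp f p (volume.restrict (Ioi (0:ℝ))))
    {c : ℝ} (hc : 0 < c) : MemLp (fun t : ℝ ↦ f (c * t)) p (volume.restrict (Ioi (0:ℝ))) :=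
  (hf.smul_measure ENNReal.ofReal_ne_top).comp_measurePreserving (measurePreserving_mul_left_Ioi hc)

/-- `‖f(c·)‖_{Lᵖ(0,∞)} = c^{−1/p} ‖f‖_{Lᵖ(0,∞)}` (`c > 0`).
[cite: Burnol2004b, §1 p. 4 (arXiv:math/0203120v7, TeX l.355–358)] -/
theorem eLpNorm_comp_mul_Ioi {p : ℝ≥0∞} {f : ℝ → ℂ}
    (hf : AEStronglyMeasurable f (volume.restrict (Ioi (0:ℝ)))) {c : ℝ} (hc : 0 < c) :
    eLpNorm (fun t : ℝ ↦ f (c * t)) p (volume.restrict (Ioi (0:ℝ))) =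
      ENNReal.ofReal c⁻¹ ^ (1 / p).toReal * eLpNorm f p (volume.restrict (Ioi (0:ℝ))) := by
  have h := eLpNorm_comp_measurePreserving (p := p) (hf.smul_measure (ENNReal.ofReal c⁻¹))
    (measurePreserving_mul_left_Ioi hc)
  rw [Function.comp_def] at h
  rw [h, eLpNorm_smul_measure_of_ne_zero, smul_eq_mul]
  simpa only [ne_eq, ENNReal.ofReal_eq_zero, not_le] using inv_pos.2 hc

/-- The `L²(0,∞)` class of the dilate: `[f(c·)] = f(c·)` a.e. on `(0,∞)`.
[cite: Burnol2004b, §1 p. 4 (arXiv:math/0203120v7, TeX l.355–358)] -/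
theorem coeFn_toLp_comp_mul_Ioi (f : Lp ℂ 2 (volume.restrict (Ioi (0:ℝ)))) {c : ℝ} (hc : 0 < c) :
    (((memLp_comp_mul_Ioi (Lp.memLp f) hc).toLp _ : Lp ℂ 2 (volume.restrict (Ioi (0:ℝ)))) : ℝ → ℂ)
      =ᵐ[volume.restrict (Ioi (0:ℝ))] fun t ↦ (f : ℝ → ℂ) (c * t) :=
  MemLp.coeFn_toLp _

/-- **The dilations are `c^{−1/2}` times unitary on `L²(0,∞)`**: `‖[f(c·)]‖ = c^{−1/2}‖f‖` (`c > 0`).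
[cite: Burnol2004b, §1 p. 4 (arXiv:math/0203120v7, TeX l.355–358)] -/
theorem norm_toLp_comp_mul_Ioi (f : Lp ℂ 2 (volume.restrict (Ioi (0:ℝ)))) {c : ℝ} (hc : 0 < c) :
    ‖((memLp_comp_mul_Ioi (Lp.memLp f) hc).toLp _ : Lp ℂ 2 (volume.restrict (Ioi (0:ℝ))))‖ =
      c⁻¹ ^ (1 / 2 : ℝ) * ‖f‖ := by
  rw [Lp.norm_toLp, Lp.norm_def, eLpNorm_comp_mul_Ioi (Lp.aestronglyMeasurable f) hc,
    ENNReal.toReal_mul, ← ENNReal.toReal_rpow, ENNReal.toReal_ofReal (inv_pos.2 hc).le]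
  norm_num

/-- **Under `U` a dilation is a translation**: if `g = f(c·)` a.e. on `(0,∞)` (`c > 0`) then
`Ug = c^{−1/2} · (Uf)(· − log c)`, since `e^{−u/2} f(c e^{−u}) = c^{−1/2} e^{−(u − log c)/2} f(e^{−(u − log c)})`.
[cite: Burnol2004b, §1 p. 4 (arXiv:math/0203120v7, TeX l.355–358) and §4 (TeX l.633–638)] -/
theorem expTransport_eq_of_comp_mul {f g : Lp ℂ 2 (volume.restrict (Ioi (0:ℝ)))} {c : ℝ} (hc : 0 < c)
    (hfg : (g : ℝ → ℂ) =ᵐ[volume.restrict (Ioi (0:ℝ))] fun t ↦ (f : ℝ → ℂ) (c * t)) :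
    expTransport g = ((Real.exp (-(Real.log c / 2)) : ℝ) : ℂ) •
      Lp.compMeasurePreserving (fun x : ℝ ↦ x - Real.log c)
        (measurePreserving_sub_right volume (Real.log c)) (expTransport f) := by
  have hT := measurePreserving_sub_right (volume : Measure ℝ) (Real.log c)
  apply Lp.ext
  have h1 := coeFn_expTransport g
  have h2 := comp_exp_neg_ae_eq hfg
  have h3 := Lp.coeFn_smul (((Real.exp (-(Real.log c / 2)) : ℝ) : ℂ))
    (Lp.compMeasurePreserving (fun x : ℝ ↦ x - Real.log c) hT (expTransport f))
  have h4 := coeFn_compSubRight (expTransport f) (Real.log c)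
  have h5 := hT.quasiMeasurePreserving.ae_eq_comp (coeFn_expTransport f)
  filter_upwards [h1, h2, h3, h4, h5] with u hu1 hu2 hu3 hu4 hu5
  simp only [Function.comp_apply] at hu5
  rw [hu1, hu2, hu3, Pi.smul_apply, hu4, hu5, smul_eq_mul]
  have e1 : Real.exp (-(u - Real.log c)) = c * Real.exp (-u) := by
    rw [neg_sub, Real.exp_sub, Real.exp_log hc, Real.exp_neg, div_eq_mul_inv]
  have e2 : Real.exp (-(Real.log c / 2)) * Real.exp (-((u - Real.log c) / 2)) =
      Real.exp (-(u / 2)) := by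
    rw [← Real.exp_add]
    ring_nf
  rw [e1, ← mul_assoc, ← Complex.ofReal_mul, e2]

/-- `c^{−(½ + 2πiξ)} = c^{−1/2} · e^{−2πi(log c)ξ}` for `c > 0`. [cite: Burnol2004b, §1 p. 4 (arXiv:math/0203120v7, TeX l.355–358)] -/
theorem cpow_neg_half_add_line {c : ℝ} (hc : 0 < c) (ξ : ℝ) :
    (c : ℂ) ^ (-(1 / 2 + 2 * π * ξ * I)) =
      ((Real.exp (-(Real.log c / 2)) : ℝ) : ℂ) * Complex.exp (((-(2 * π * Real.log c * ξ) : ℝ) : ℂ) * I) := by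
  rw [Complex.cpow_def_of_ne_zero (Complex.ofReal_ne_zero.2 hc.ne'), ← Complex.ofReal_log hc.le,
    Complex.ofReal_exp, ← Complex.exp_add]
  congr 1
  push_cast
  ring

/-- **The dilation law** `𝓜(f(c·))(ξ) = c^{−(½+2πiξ)}·𝓜f(ξ)` a.e. (`c > 0`): if `g = f(c·)` a.e. on
`(0,∞)` then `mellinL2 g = (ξ ↦ c^{−(½+2πiξ)} (mellinL2 f)(ξ))` a.e. — the `L²`-operator form of
Mathlib's `mellin_comp_mul_left` (`𝓜(f(c·))(s) = c^{−s}𝓜f(s)` at `s = ½ + 2πiξ`); "scale invariant hence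
diagonalized by the Mellin Transform". [cite: Burnol2004b, §1 p. 4 (arXiv:math/0203120v7, TeX l.355–358)] -/
theorem mellinL2_ae_eq_of_comp_mul {f g : Lp ℂ 2 (volume.restrict (Ioi (0:ℝ)))} {c : ℝ} (hc : 0 < c)
    (hfg : (g : ℝ → ℂ) =ᵐ[volume.restrict (Ioi (0:ℝ))] fun t ↦ (f : ℝ → ℂ) (c * t)) :
    (mellinL2 g : ℝ → ℂ) =ᵐ[volume]
      fun ξ ↦ (c : ℂ) ^ (-(1 / 2 + 2 * π * ξ * I)) * (mellinL2 f : ℝ → ℂ) ξ := by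
  rw [mellinL2_apply, mellinL2_apply, expTransport_eq_of_comp_mul hc hfg, fourier_smul,
    fourier_compSubRight]
  filter_upwards [Lp.coeFn_smul (((Real.exp (-(Real.log c / 2)) : ℝ) : ℂ))
      (((memLp_top_phase (Real.log c)).toLp _ : Lp ℂ ∞ (volume : Measure ℝ)) •
        (𝓕 (expTransport f) : Lp ℂ 2 (volume : Measure ℝ)) : Lp ℂ 2 (volume : Measure ℝ)),
    Lp.coeFn_lpSMul (r := 2) ((memLp_top_phase (Real.log c)).toLp _ : Lp ℂ ∞ (volume : Measure ℝ))
      (𝓕 (expTransport f) : Lp ℂ 2 (volume : Measure ℝ)),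
    coeFn_phase (Real.log c)] with ξ h1 h2 h3
  rw [h1, Pi.smul_apply, h2, Pi.smul_apply', h3, smul_eq_mul, smul_eq_mul, cpow_neg_half_add_line hc]
  exact (mul_assoc _ _ _).symm

/-- The dilation law for the class of the dilate: `mellinL2 [f(c·)] = (ξ ↦ c^{−(½+2πiξ)} (mellinL2 f)(ξ))`
a.e. (`c > 0`). [cite: Burnol2004b, §1 p. 4 (arXiv:math/0203120v7, TeX l.355–358)] -/
theorem mellinL2_toLp_comp_mul (f : Lp ℂ 2 (volume.restrict (Ioi (0:ℝ)))) {c : ℝ} (hc : 0 < c) :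
    (mellinL2 ((memLp_comp_mul_Ioi (Lp.memLp f) hc).toLp fun t ↦ (f : ℝ → ℂ) (c * t)) : ℝ → ℂ)
      =ᵐ[volume] fun ξ ↦ (c : ℂ) ^ (-(1 / 2 + 2 * π * ξ * I)) * (mellinL2 f : ℝ → ℂ) ξ :=
  mellinL2_ae_eq_of_comp_mul hc (MemLp.coeFn_toLp _)

end MellinL2

end Literature.Analysis.FunctionSpaces

end
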